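import Summits.CriticalPhenomena.CardyFormulaZ2.Theorems.CardyComplexConeDefs
import Summits.CriticalPhenomena.CardyFormulaZ2.Theorems.CardyComplexConeCoherentMoreraPairingBound
import Summits.CriticalPhenomena.CardyFormulaZ2.Theorems.CardyComplexConeCoherentMoreraTraceIdentity
import Summits.CriticalPhenomena.CardyFormulaZ2.Theorems.CardyComplexConeCoherentMoreraSiteRegrouping
import Summits.CriticalPhenomena.CardyFormulaZ2.Theorems.CardyComplexConeCoherentMoreraModeSelection
import Summits.CriticalPhenomena.CardyFormulaZ2.Theorems.CardyComplexConeCoherentMoreraPrecompactTransfer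
import Summits.CriticalPhenomena.CardyFormulaZ2.Theorems.CardyComplexConeCoherentMoreraCoherenceShift
import Summits.CriticalPhenomena.CardyFormulaZ2.Theorems.CardyComplexConeCoherentMoreraKirchhoff

/-!
# Line `finitary-green-pairing` for the crux `CardyComplexCone.CoherentMorera`
(item stmt-CriticalPhenomena-11388, route CardyComplexCone, rank 4) — lead's working skeleton

The crux: `EdgeCoherence → EdgePrecompact → (WeakHolomorphyFamilies ∧ VertexPrecompactFamilies)` for the
spin-`1/3` parafermionic observables of critical bond percolation on `δℤ²` (family form, lattice-edge
guards).  The vocabulary and the seven registered stub statements `Sig.stub_*` live in the landed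
definitions module `Theorems/CardyComplexConeDefs.lean` (namespace `…Cruxes.CoherentMorera.FinitaryGreenPairing`);
the landed stubs are imported:

* `stub_pairingBound` — summation by parts (`…CoherentMoreraPairingBound`, p86783);
* `stub_traceIdentity` — the trace identity in expectation on compacts (`…CoherentMoreraTraceIdentity`, p90453);
* `stub_siteRegrouping` — vertex pairing ⟺ `A₀` site pairing (`…CoherentMoreraSiteRegrouping`, p91643);
* `stub_modeSelection` — character-or-null ⇒ one mode pairing null (`…CoherentMoreraModeSelection`, p92583);
* `stub_precompactTransfer` — clause (ii) from `EdgePrecompact` (`…CoherentMoreraPrecompactTransfer`, p92947);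
* `stub_coherenceShift` — quarter-turn covariance + universality (`…CoherentMoreraCoherenceShift`, p93842);
* `stub_kirchhoff` — Kirchhoff's vertex relation `χ = +i` (DC12 Prop. 4) for the percolation corner observable,
  family form, from the datum-form `cornerObs_vertexRelation` of the sibling crux `EdgePrecompact`
  (`…CoherentMoreraKirchhoff`, lead).

Nothing is sorried: the composition `CoherentMorera_of` is a real proof (filter algebra) and
`CoherentMorera_proof` concludes the crux BY NAME from the seven landed stubs.
-/

noncomputable section

namespace Summit.CriticalPhenomena.CardyFormulaZ2.Cruxes.CoherentMorera.FinitaryGreenPairing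

open scoped BigOperators Topology
open Filter Set MeasureTheory
open Literature.Probability.LatticeModels Literature.Probability.RandomPlanarGeometry
open Literature.Probability.Percolation (BondConfig bondPercolation half)
open Summit.CriticalPhenomena.CardyFormulaZ2.Theses.CardyComplexCone
  (EdgeCoherence EdgePrecompact CoherentMorera)

/-! ### Certificates: the copies ARE the crux's texts -/

/-- `EdgeCoherence` is `∃ u ≠ 0 (on a class), EdgeCoherenceWith u`, by `Iff.rfl`. -/
theorem edgeCoherence_iff :
    EdgeCoherence ↔ ∃ u : Site 2 → ℂ, (∃ o : Site 2, IsCorner 0 o ∧ u o ≠ 0) ∧ EdgeCoherenceWith u :=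
  Iff.rfl

/-- The crux is `EdgeCoherence → EdgePrecompact → (clause (i) ∧ clause (ii))` with clause (i) =
`ScaledNull (PV Λ φ)` and clause (ii) = `VertexPrecompactAt D Λ` under the guards (definitional). -/
theorem coherentMorera_iff :
    CoherentMorera ↔ (EdgeCoherence → EdgePrecompact →
      (∀ (D : DobrushinDomain) (Λ : ℝ → DiscreteDobrushin), (∀ δ, (Λ δ).Ω = D.carrier) →
        (∀ δ, (Λ δ).δ = δ) → (∀ᶠ δ in 𝓝[>] (0:ℝ), (Λ δ).IsZdAdmissible) →
          ∀ φ : ℂ → ℂ, ContDiff ℝ (⊤ : ℕ∞) φ → HasCompactSupport φ → tsupport φ ⊆ D.carrier →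
            ScaledNull (PV Λ φ)) ∧
      (∀ (D : DobrushinDomain) (Λ : ℝ → DiscreteDobrushin), (∀ δ, (Λ δ).Ω = D.carrier) →
        (∀ δ, (Λ δ).δ = δ) → (∀ᶠ δ in 𝓝[>] (0:ℝ), (Λ δ).IsZdAdmissible) → VertexPrecompactAt D Λ)) :=
  Iff.rfl

/-! ### Glue (elementary, proved): the spin-shift pairing and the disjunction elimination -/

/-- The norm of the normalisation `δ^{5/3}` (as a complex number), `δ > 0`. -/
theorem norm_scale {δ : ℝ} (hδ : 0 < δ) : ‖(((δ ^ ((5:ℝ) / 3) : ℝ)) : ℂ)‖ = δ ^ ((5:ℝ) / 3) := by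
  rw [Complex.norm_real, Real.norm_eq_abs, abs_of_nonneg (Real.rpow_nonneg hδ.le _)]

/-- `δ^{5/3}/δ = δ^{2/3}` for `δ > 0`. -/
theorem rpow_fiveThirds_div {δ : ℝ} (hδ : 0 < δ) : δ ^ ((5:ℝ) / 3) / δ = δ ^ ((2:ℝ) / 3) := by
  rw [show (2:ℝ) / 3 = 5 / 3 - 1 by norm_num, Real.rpow_sub_one hδ.ne']

/-- **The spin-shift pairing (L1 for percolation): `δ^{5/3}·(P₀ − i·P₂) → 0`** — from the summation by
parts (stub 1 on a thickening `U` of `tsupport φ` inside `D`), Kirchhoff for percolation (stub 2 on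
the closed thickening) and `|E_δ| ≤ 1`. -/
theorem spinShift_of (hPB : Sig.stub_pairingBound) (hKi : Sig.stub_kirchhoff) (D : DobrushinDomain)
    (Λ : ℝ → DiscreteDobrushin) (hG : Guards D Λ) (φ : ℂ → ℂ) (hT : TestFn D φ) :
    Tendsto (fun δ : ℝ => ((δ ^ ((5:ℝ) / 3) : ℝ) : ℂ) * (P0 Λ φ δ - Complex.I * P2 Λ φ δ))
      (𝓝[>] (0:ℝ)) (𝓝 0) := by
  obtain ⟨hφ, hsupp, hsub⟩ := hT
  obtain ⟨ρ, hρ, hρD⟩ := hsupp.isCompact.exists_cthickening_subset_open D.isOpen hsub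
  have hUo : IsOpen (Metric.thickening ρ (tsupport φ)) := Metric.isOpen_thickening
  have hsU : tsupport φ ⊆ Metric.thickening ρ (tsupport φ) := Metric.self_subset_thickening hρ _
  have hUK : Metric.thickening ρ (tsupport φ) ⊆ Metric.cthickening ρ (tsupport φ) :=
    Metric.thickening_subset_cthickening _ _
  obtain ⟨C, δ₀, hδ₀, hB⟩ := hPB _ hUo φ hφ hsupp hsU
  have hK : IsCompact (Metric.cthickening ρ (tsupport φ)) := hsupp.isCompact.cthickening
  have hKi' := hKi D Λ hG _ hK hρD
  have hpos : ∀ᶠ δ in 𝓝[>] (0:ℝ), 0 < δ := eventually_mem_nhdsWithin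
  have hle : ∀ᶠ δ in 𝓝[>] (0:ℝ), δ ∈ Set.Ioc 0 δ₀ := Ioc_mem_nhdsGT hδ₀
  have hbd : ∀ᶠ δ in 𝓝[>] (0:ℝ), ‖P0 Λ φ δ - Complex.I * P2 Λ φ δ‖ ≤ C * 1 / δ := by
    filter_upwards [hKi', hle] with δ hk hδI
    exact hB δ hδI.1 hδI.2 (cornerObs Λ δ) 1 zero_le_one (fun c => SiteRegrouping.norm_cornerObs_le_one Λ δ c)
      (fun x i hx => hk x i (hUK hx))
  have hup : ∀ᶠ δ in 𝓝[>] (0:ℝ),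
      ‖((δ ^ ((5:ℝ) / 3) : ℝ) : ℂ) * (P0 Λ φ δ - Complex.I * P2 Λ φ δ)‖ ≤ C * δ ^ ((2:ℝ) / 3) := by
    filter_upwards [hbd, hpos] with δ hb hδ
    rw [norm_mul, norm_scale hδ]
    calc δ ^ ((5:ℝ) / 3) * ‖P0 Λ φ δ - Complex.I * P2 Λ φ δ‖
        ≤ δ ^ ((5:ℝ) / 3) * (C * 1 / δ) := mul_le_mul_of_nonneg_left hb (Real.rpow_nonneg hδ.le _)
      _ = C * (δ ^ ((5:ℝ) / 3) / δ) := by ring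
      _ = C * δ ^ ((2:ℝ) / 3) := by rw [rpow_fiveThirds_div hδ]
  have hlim : Tendsto (fun δ : ℝ => C * δ ^ ((2:ℝ) / 3)) (𝓝[>] (0:ℝ)) (𝓝 0) := by
    simpa using SiteRegrouping.tendsto_rpow_twoThirds.const_mul C
  rw [tendsto_zero_iff_norm_tendsto_zero]
  exact squeeze_zero' (Eventually.of_forall fun δ => norm_nonneg _) hup hlim

/-- **Disjunction elimination**: if `δ^{5/3}(P_a − i·P_b) → 0` and one of `δ^{5/3}P_a`, `δ^{5/3}P_b`
tends to `0`, then `δ^{5/3}P_a → 0`. -/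
theorem scaledNull_of_sub_of_or {Pa Pb : ℝ → ℂ}
    (hA : Tendsto (fun δ : ℝ => ((δ ^ ((5:ℝ) / 3) : ℝ) : ℂ) * (Pa δ - Complex.I * Pb δ))
      (𝓝[>] (0:ℝ)) (𝓝 0))
    (hsel : ScaledNull Pa ∨ ScaledNull Pb) : ScaledNull Pa := by
  rcases hsel with h | h
  · exact h
  · unfold ScaledNull at h ⊢
    have h2 := (hA.add (h.const_mul Complex.I))
    rw [mul_zero, add_zero] at h2
    refine h2.congr' (Eventually.of_forall fun δ => ?_)
    ring

/-! ### The composition: the seven stubs give the crux BY NAME -/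

/-- **The line.** Summation by parts + Kirchhoff for percolation + the trace identity + site regrouping +
quarter-turn covariance + mode selection + precompact transfer imply `CoherentMorera` (real proof: pure
logic and the two elementary glue lemmas above; `EdgeCoherence` enters only through stubs 5–6,
`EdgePrecompact` only through stub 7). -/
theorem CoherentMorera_of :
    Sig.stub_pairingBound → Sig.stub_kirchhoff → Sig.stub_traceIdentity → Sig.stub_siteRegrouping →
      Sig.stub_coherenceShift → Sig.stub_modeSelection → Sig.stub_precompactTransfer →
        CoherentMorera := by
  intro hPB hKi hTr hSR hSh hMS hPT hC hP
  refine ⟨?_, ?_⟩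
  · intro D Λ hΩ hδ hadm φ hφ hsupp hsub
    have hG : Guards D Λ := ⟨hΩ, hδ, hadm⟩
    have hT : TestFn D φ := ⟨hφ, hsupp, hsub⟩
    obtain ⟨u, hu0, hu⟩ := hC
    have h0 : ScaledNull (P0 Λ φ) :=
      scaledNull_of_sub_of_or (spinShift_of hPB hKi D Λ hG φ hT)
        (hMS u hu0 hu (hSh u hu) D Λ hG φ hT)
    exact (hSR D Λ hG (hTr D Λ hG) φ hT).2 h0
  · intro D Λ hΩ hδ hadm
    exact hPT hP D Λ ⟨hΩ, hδ, hadm⟩ (hTr D Λ ⟨hΩ, hδ, hadm⟩)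

/-- **The crux `CoherentMorera`** (route `CardyComplexCone`, stmt-CriticalPhenomena-11388), BY NAME, from the
seven landed stubs of the line `finitary-green-pairing`. -/
theorem CoherentMorera_proof : CoherentMorera :=
  CoherentMorera_of stub_pairingBound stub_kirchhoff stub_traceIdentity stub_siteRegrouping
    stub_coherenceShift stub_modeSelection stub_precompactTransfer

end Summit.CriticalPhenomena.CardyFormulaZ2.Cruxes.CoherentMorera.FinitaryGreenPairing

end
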